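import Summits.HodgeConjecture.Ring2.RowFourTypeIOneMumford
import Literature.AlgebraicGeometry.HodgeTheory.AbelianFourfoldEndRankOneHodgeClasses
import HarnessLib

/-!
# Ring 2 (cell topic `Summits/HodgeConjecture/Ring2/`; seat `lit`, gen 73, R50-F4): ROW I(1) IS CLOSED — the Hodge conjecture for EVERY complex abelian fourfold with `End⁰ = ℚ`, unconditionally; type I(1) leaves the row-four residual entirely

HONEST FRAMING (cell `pub-hodge-ring2`, verbatim): research route conditional on HC_CM; not a corollary;
Q11.4-sentence-2 already refuted in dim ≥ 3. `HC_CM` occurs ONLY as the binder `hCM` of the product row of §0. Markman's theorem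
(`Markman2025_weilClasses_algebraic_abelianFourfold`) is a HYPOTHESIS of the axis theorems of §1, never asserted. Theorems only —
no definition, no named fact, no `sorry`. Conventions as in `RowFourTypeIOneSymplectic`: the instance hypothesis
`[HodgeTensorFacts.{0, 0}]` (= the tree's theorem `hodgeTensorFacts_holds`) is a section binder; the real Hodge model and the
`(p,q)`-independence are the tree's theorems `exists_isReal_hodgeModel_holds`, `hodgePQ_independent_of_hodgeModel_holds`.

THE PRINT. B. Moonen, Yu. Zarhin, Math. Ann. **315** (1999), Thm. (0.1)(3) [held text `paper:arxiv-math_9901113` p. 1, L112–118]: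
«Suppose we are in case (d) [`X` simple of dimension 4 with `End⁰(X) = ℚ`]. Then the Hodge ring `B•(X)` is generated by divisor
classes, i.e., `B•(X) = D•(X)`. Either `Hg(X) = Sp(V,φ)` … or `Hg(X)` is isogenous to a `ℚ`-form of `SL₂ × SL₂ × SL₂` …»;
§2 (2.5)(1) [p. 5, L142–148] «In both cases the Hodge ring of `X` is generated by divisor classes».

THIS FILE (sequel of `RowFourTypeIOneSymplectic` / `RowFourTypeIOneMumford`, which closed the branch `Hg = Sp` and identified
what was left of row I(1) with the Mumford position). Input: the Literature lane's UNCONDITIONAL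
`HodgeTheory/AbelianFourfoldEndRankOneHodgeClasses` (lit g73 F3: `B²(X) ⊆ D²(X) ⊗ ℂ` and `HC(X)` for every fourfold with
`finrank_ℚ End⁰ = 1`, the Mumford branch computed through `SL2Triple.exists_cubeBasis`, Theorem L-Hg and the invariants of
`SL₂³` on `(2 ⊠ 2 ⊠ 2)^{⊗4}`; its F1 `Motives/HodgeLieWeightOneRankEightMumfordNormalForm`, F2
`RepresentationTheory/GeneralLinear/SL2TripleCubeBasis`).
* §0 the cell, pointwise and UNCONDITIONAL (no Markman, no `HC_CM`): **`isCodimTwoDivisorWeilGenerated_of_finrank_endAlgebra_eq_one`**,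
  **`hodgeConjectureFor_of_finrank_endAlgebra_eq_one`**, **`isDivisorGenerated_of_finrank_endAlgebra_eq_one`** (`B•(X) = D•(X) ⊗ ℂ`,
  all codimensions), `endRankOneFourfold_hcOnClass` (+ `_of_hodgeConjecture`, on path) — for EVERY complex abelian fourfold `X` with
  `finrank_ℚ End⁰(X) = 1`, BOTH branches of the dichotomy; **`endRankOne_dimLeFive_hcOnClass`** — HC for EVERY complex abelian
  variety of dimension `≤ 5` with `finrank_ℚ End⁰ = 1`, UNCONDITIONAL (dim `≤ 3` MZ99 Introduction, `4` here, `5` `Hg = Sp₁₀`);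
  and the `HC_CM` binder row
  `hodgeConjectureFor_prod_of_finrank_endAlgebra_eq_one_of_cmHodgeHypothesis` (`X × C`, `C` of CM type; `HC_CM` and the Lombardo
  span fact as ARGUMENTS).
* §1 **`moonenZarhin1999_codimTwoHodgeClasses_abelianFourfold_iff_residual_noTypeIOne`** — the FOURFOLD FACT is EQUIVALENT to
  `B² ⊆ D² + Σ W_K` on the simple non-CM fourfolds with `finrank_ℚ End⁰ ≠ 1` and none of: imaginary quadratic endomorphism
  algebra, minimal quaternion type, maximal real multiplication, real multiplication of relative dimension two, type II of
  quaternion rank two, quartic CM type `{(1,1),(2,0)}` — what is left of Moonen–Zarhin 1995: III over `ℚ`, IV(2,1) `⊇ k` of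
  signature `(2,2)`, IV with `d = 2`; TYPE I(1) IS GONE.
* §2 **`hcUpToDim_five_iff_rowFour_noTypeIOne_of_markman`**, `hcAtDim_four_iff_rowFour_noTypeIOne_of_markman` — MODULO MARKMAN
  ALONE, `HCUpToDim 5` / `HCAtDim 4` are EQUIVALENT to the Hodge conjecture on that residual class;
  `rowFourNoTypeIOne_hcOnClass_of_hodgeConjecture` (on path).

WHAT IS NOT CLAIMED: the residual is NOT closed (type III over `ℚ` and the two type IV rows carry exceptional classes); nothing
about `X²` for `X` in the Mumford position (MZ99: exceptional classes in `B²(X²)`); Markman is never asserted; no `HC_CM`.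

## References
* [MoonenZarhin1999LowDim] B. Moonen, Yu. Zarhin, Math. Ann. 315 (1999), Thm. 0.1, Thm. (0.1)(3), §1 (1.8), §2 (2.2)–(2.5).
* [MoonenZarhin1995Duke] B. Moonen, Yu. Zarhin, Duke Math. J. 77 (1995), §2 (type I(1)).
* [Mumford1969NoteShimura] D. Mumford, Math. Ann. 181 (1969), §4.
* [vanGeemen1994HodgeAV] B. van Geemen, LNM 1594 (1994), §2.4, Thm. 4.2.
* [Deligne2000] P. Deligne, *The Hodge conjecture* (Clay problem description, 2000), §1.
* [Lombardo2016] D. Lombardo, *On the ℓ-adic Galois representations …* (2016), Lemma 3.4 (p. 1229).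
* [VoisinHodgeI2002] C. Voisin, *Hodge Theory I* (2002), Thm. 6.25, Rem. 6.27.
* [claim: Markman2025SurveySecant, status: under-review] E. Markman, arXiv:2509.23403, Thm. 1.2.
-/

noncomputable section

open CategoryTheory CategoryTheory.Limits
open scoped TensorProduct

namespace Summit.HodgeConjecture.Ring2.RowFourTypeIOneClosed

open Literature.AlgebraicGeometry.Motives (AbelianVariety bettiCohomology HodgeTensorFacts IsSmoothProjective)
open Literature.AlgebraicGeometry.Motives.AbelianVariety
open Literature.AlgebraicGeometry.HodgeTheory
open Literature.AlgebraicGeometry.ComplexMultiplication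
open Literature.AlgebraicGeometry.Milne1999
open Literature.Barriers.HodgeConjecture
open NumberField
open Literature.NumberTheory.Automorphic (IsQuaternionAlgebra)
open Literature.RingTheory.CentralSimple
open Summit.HodgeConjecture.HodgeConjecture.Ring2.ClassTargets
open Summit.HodgeConjecture.Ring2.FivefoldFactHolds
open Summit.HodgeConjecture.Ring2.NonSimpleFourfoldsCodimTwo
open Summit.HodgeConjecture.Ring2.RowFourTypeIVOneOne
open Summit.HodgeConjecture.Ring2.RowFourTypeITwo
open Summit.HodgeConjecture.Ring2.RowFourTypeIIOverQ
open Summit.HodgeConjecture.Ring2.RowFourTypeIOneSymplectic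

variable [HodgeTensorFacts.{0, 0}] {X : AbelianVariety ℂ}

/-! ### §0 The cell: every complex abelian fourfold with `End⁰ = ℚ`, unconditionally -/

/-- **`B²(X) ⊆ D²(X) ⊗ ℂ` for EVERY complex abelian fourfold with `finrank_ℚ End⁰(X) = 1` — UNCONDITIONAL** (MZ99 Thm. (0.1)(3)
«Then the Hodge ring `B•(X)` is generated by divisor classes», in codimension two, both branches; a polarization of `H¹` exists
by `smoothProjective_hodgeStructure_isPolarizable_holds`). [cite: MoonenZarhin1999LowDim, Thm. (0.1)(3) and §2 (2.5)(1)]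
[cite: MoonenZarhin1995Duke, §2 (type I(1))] [cite: Mumford1969NoteShimura, §4] -/
theorem mem_divisorClassesSpan_two_of_finrank_endAlgebra_eq_one (h1 : Module.finrank ℚ X.endAlgebra = 1) (h4 : X.dim = 4)
    {c : complexBetti X.X (2 * 2)} (hcQ : IsRationalClass c) (hc : IsOfHodgeType X.dim X.X (2 * 2) 2 2 c) :
    c ∈ divisorClassesSpan X.X X.dim 2 := by
  haveI : Module.Finite ℚ (bettiCohomology X.X 1) := finite_bettiCohomology_one X
  have hX : IsSmoothProjective X.dim X.X := isSmoothProjective_holds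
  obtain ⟨ψ⟩ : (BettiUniverse.hodge exists_isReal_hodgeModel_holds (isSmoothProjective_holds (A := X)) 1).IsPolarizable :=
    smoothProjective_hodgeStructure_isPolarizable_holds hX
      (BettiUniverse.realHodgeModel exists_isReal_hodgeModel_holds hX)
      (BettiUniverse.realHodgeModel_isHodgeSymmetric exists_isReal_hodgeModel_holds hX) 1
  exact mem_divisorClassesSpan_two_of_finrank_endAlgebra_eq_one_of_dim_eq_four exists_isReal_hodgeModel_holds
    hodgePQ_independent_of_hodgeModel_holds h1 h4 ψ hcQ hc

/-- **`IsCodimTwoDivisorWeilGenerated X` (`B²(X) ⊆ D²(X) + Σ W_K`) for EVERY complex abelian fourfold with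
`finrank_ℚ End⁰(X) = 1` — UNCONDITIONAL.** [cite: MoonenZarhin1999LowDim, Thm. 0.1 and Thm. (0.1)(3)]
[cite: MoonenZarhin1995Duke, §2 (type I(1))] -/
theorem isCodimTwoDivisorWeilGenerated_of_finrank_endAlgebra_eq_one (h1 : Module.finrank ℚ X.endAlgebra = 1)
    (h4 : X.dim = 4) : IsCodimTwoDivisorWeilGenerated X :=
  fun _ hcQ hc => Submodule.mem_sup_left (mem_divisorClassesSpan_two_of_finrank_endAlgebra_eq_one h1 h4 hcQ hc)

/-- **THE HODGE CONJECTURE FOR EVERY COMPLEX ABELIAN FOURFOLD WITH `finrank_ℚ End⁰(X) = 1` — UNCONDITIONAL** (no Markman, no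
`HC_CM`): MZ99 Thm. (0.1)(3), case (d), both branches («Either `Hg(X) = Sp(V,φ)` … or `Hg(X)` is isogenous to a `ℚ`-form of
`SL₂ × SL₂ × SL₂`»; «In both cases the Hodge ring of `X` is generated by divisor classes»), and `HC(X) ⟺ HC²(X)` for a fourfold.
[cite: MoonenZarhin1999LowDim, Thm. (0.1)(3) and §2 (2.5)(1)] [cite: vanGeemen1994HodgeAV, §2.4] [cite: Mumford1969NoteShimura, §4] -/
theorem hodgeConjectureFor_of_finrank_endAlgebra_eq_one (h1 : Module.finrank ℚ X.endAlgebra = 1) (h4 : X.dim = 4) :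
    HodgeConjectureFor X.dim X.X := by
  haveI : Module.Finite ℚ (bettiCohomology X.X 1) := finite_bettiCohomology_one X
  have hX : IsSmoothProjective X.dim X.X := isSmoothProjective_holds
  obtain ⟨ψ⟩ : (BettiUniverse.hodge exists_isReal_hodgeModel_holds (isSmoothProjective_holds (A := X)) 1).IsPolarizable :=
    smoothProjective_hodgeStructure_isPolarizable_holds hX
      (BettiUniverse.realHodgeModel exists_isReal_hodgeModel_holds hX)
      (BettiUniverse.realHodgeModel_isHodgeSymmetric exists_isReal_hodgeModel_holds hX) 1
  exact hodgeConjectureFor_of_finrank_endAlgebra_eq_one_of_dim_eq_four exists_isReal_hodgeModel_holds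
    hodgePQ_independent_of_hodgeModel_holds h1 h4 ψ

/-- **`B•(X) = D•(X) ⊗ ℂ` IN ALL CODIMENSIONS (`IsDivisorGenerated X`) for EVERY complex abelian fourfold with
`finrank_ℚ End⁰(X) = 1` — UNCONDITIONAL**: MZ99 Thm. (0.1)(3) as printed («B•(X) = D•(X)»; codimensions 3, 4 by hard Lefschetz).
[cite: MoonenZarhin1999LowDim, Thm. (0.1)(3) and Introduction (p. 711)] [cite: VoisinHodgeI2002, Thm. 6.25 and Rem. 6.27] -/
theorem isDivisorGenerated_of_finrank_endAlgebra_eq_one (h1 : Module.finrank ℚ X.endAlgebra = 1) (h4 : X.dim = 4) :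
    IsDivisorGenerated X :=
  isDivisorGenerated_of_dim_le_five_of_codimTwo X (by omega) fun _ hcQ hc =>
    mem_divisorClassesSpan_two_of_finrank_endAlgebra_eq_one h1 h4 hcQ hc

/-- **The `HC_CM` row of the cell for type I(1) fourfolds**: granted the CM Hodge hypothesis at every abelian variety (binder
`hCM` — the cell's `HC_CM`, an ARGUMENT, never asserted) and the Lombardo span fact (binder `hL`), the Hodge conjecture holds for
`X × C` for EVERY complex abelian fourfold `X` with `finrank_ℚ End⁰(X) = 1` and EVERY abelian variety `C` of CM type: `X` has
no factor of type IV (`hasNoTypeIVFactor_of_finrank_endAlgebra_eq_one`) and `B(X) = D(X)` (`isDivisorGenerated_of_finrank_endAlgebra_eq_one`),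
so `hodgeConjectureFor_prod_of_cmHodgeHypothesis_of_isDivisorGenerated` applies.  research route conditional on HC_CM; not a
corollary.  [cite: Lombardo2016, Lemma 3.4 (p. 1229)] [cite: MoonenZarhin1999LowDim, Thm. (0.1)(3)] [cite: vanGeemen1994HodgeAV, §2.4] -/
theorem hodgeConjectureFor_prod_of_finrank_endAlgebra_eq_one_of_cmHodgeHypothesis
    (hCM : ∀ B : AbelianVariety ℂ, CMHodgeHypothesisAt B) (hL : Lombardo2016_hodgeClassesProductSpan)
    (h1 : Module.finrank ℚ X.endAlgebra = 1) (h4 : X.dim = 4) (C : AbelianVariety ℂ) (hCt : IsOfCMType C) :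
    HodgeConjectureFor (X.prod C).dim (X.prod C).X :=
  hodgeConjectureFor_prod_of_cmHodgeHypothesis_of_isDivisorGenerated hCM hL X C
    (hasNoTypeIVFactor_of_finrank_endAlgebra_eq_one h1) hCt (isDivisorGenerated_of_finrank_endAlgebra_eq_one h1 h4)

/-- **The class of complex abelian fourfolds with `finrank_ℚ End⁰ = 1` is a CLOSED class target, unconditionally** (`HCOnClass`,
no Markman, no `HC_CM`). [cite: MoonenZarhin1999LowDim, Thm. (0.1)(3)] [cite: vanGeemen1994HodgeAV, §2.4] -/
theorem endRankOneFourfold_hcOnClass : HCOnClass fun A => A.dim = 4 ∧ Module.finrank ℚ A.endAlgebra = 1 :=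
  fun _ hA => hodgeConjectureFor_of_finrank_endAlgebra_eq_one hA.2 hA.1

omit [HodgeTensorFacts.{0, 0}] in
/-- **On path**: the class is a case of the summit. [cite: Deligne2000, §1] -/
theorem endRankOneFourfold_hcOnClass_of_hodgeConjecture (h : _root_.HodgeConjecture) :
    HCOnClass fun A => A.dim = 4 ∧ Module.finrank ℚ A.endAlgebra = 1 :=
  hcOnClass_of_hodgeConjecture _ h

/-- **`B•(A) = D•(A) ⊗ ℂ` for EVERY complex abelian variety of dimension `≤ 5` with `finrank_ℚ End⁰(A) = 1` — UNCONDITIONAL**: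
dimension `≤ 3` is Moonen–Zarhin's introductory remark (`isDivisorGenerated_of_dim_le_three`), dimension `4` is
`isDivisorGenerated_of_finrank_endAlgebra_eq_one` (both branches of Thm. (0.1)(3)), dimension `5` is `Hg = Sp₁₀`
(`AbelianVariety.isDivisorGenerated_of_fivefold_endRankOne`, MZ99 (2.6)–(2.7)).
[cite: MoonenZarhin1999LowDim, Introduction (p. 711), Thm. (0.1)(3), §2 (2.6)–(2.7)] -/
theorem isDivisorGenerated_of_finrank_endAlgebra_eq_one_of_dim_le_five (h1 : Module.finrank ℚ X.endAlgebra = 1)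
    (h5 : X.dim ≤ 5) : IsDivisorGenerated X := by
  by_cases h3 : X.dim ≤ 3
  · exact isDivisorGenerated_of_dim_le_three X h3
  · rcases (show X.dim = 4 ∨ X.dim = 5 by omega) with h4 | h5'
    · exact isDivisorGenerated_of_finrank_endAlgebra_eq_one h1 h4
    · exact AbelianVariety.isDivisorGenerated_of_fivefold_endRankOne X h1 h5'

/-- **THE HODGE CONJECTURE FOR EVERY COMPLEX ABELIAN VARIETY OF DIMENSION `≤ 5` WITH `finrank_ℚ End⁰ = 1` — UNCONDITIONAL**
(a closed class target `HCOnClass`; no Markman, no `HC_CM`): `B = D` in all these dimensions and van Geemen §2.4.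
[cite: MoonenZarhin1999LowDim, Introduction (p. 711), Thm. (0.1)(3), §2 (2.6)–(2.7)] [cite: vanGeemen1994HodgeAV, §2.4] -/
theorem endRankOne_dimLeFive_hcOnClass : HCOnClass fun A => A.dim ≤ 5 ∧ Module.finrank ℚ A.endAlgebra = 1 :=
  fun A hA => hodgeConjectureFor_of_isDivisorGenerated A (isDivisorGenerated_of_finrank_endAlgebra_eq_one_of_dim_le_five hA.2 hA.1)

omit [HodgeTensorFacts.{0, 0}] in
/-- **On path**: the class is a case of the summit. [cite: Deligne2000, §1] -/
theorem endRankOne_dimLeFive_hcOnClass_of_hodgeConjecture (h : _root_.HodgeConjecture) :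
    HCOnClass fun A => A.dim ≤ 5 ∧ Module.finrank ℚ A.endAlgebra = 1 :=
  hcOnClass_of_hodgeConjecture _ h

/-! ### §1 The fourfold fact localised past ALL type I(1) fourfolds -/

/-- **THE RESIDUAL OF THE FOURFOLD FACT, EIGHTH REFINEMENT — TYPE I(1) REMOVED.** The named fact
`MoonenZarhin1999_codimTwoHodgeClasses_abelianFourfold` (Thm. 0.1 in codimension two) is EQUIVALENT to its instances at the
simple non-CM fourfolds whose endomorphism algebra is NOT an imaginary quadratic field, which are NOT of minimal quaternion
type, NOT of maximal real-multiplication type, NOT of real-multiplication type of relative dimension two, NOT of type II of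
quaternion rank two, NOT of quartic CM type `{(1,1),(2,0)}`, and whose endomorphism algebra has `finrank_ℚ ≠ 1`: by §0 the
fourfolds with `End⁰ = ℚ` are UNCONDITIONALLY divisorial in codimension two (both branches of the dichotomy). What is left of
Moonen–Zarhin 1995: III over `ℚ`, IV(2,1) `⊇ k` of signature `(2,2)`, IV with `d = 2`.
[cite: MoonenZarhin1999LowDim, Thm. (0.1)(3), §1 (1.8), §2 (2.2)–(2.5)] [cite: MoonenZarhin1995Duke, §2 (type I(1))] -/
theorem moonenZarhin1999_codimTwoHodgeClasses_abelianFourfold_iff_residual_noTypeIOne :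
    MoonenZarhin1999_codimTwoHodgeClasses_abelianFourfold ↔
      ∀ A : AbelianVariety ℂ, A.dim = 4 → A.IsSimple → ¬ IsOfCMType A →
        (¬ ∃ (φ : A ⟶ A) (d : ℕ), 0 < d ∧ φ ≫ φ = -(d • 𝟙 A) ∧ Module.finrank ℚ A.endAlgebra = 2) →
        (¬ ∃ (K : Type) (_ : Field K) (_ : NumberField K) (_ : IsTotallyReal K) (_ : Algebra K A.endAlgebra)
          (_ : IsScalarTower ℚ K A.endAlgebra) (_ : IsQuaternionAlgebra K A.endAlgebra),
            A.dim = 2 * Module.finrank ℚ K) →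
        (¬ ∃ hF : IsField A.endAlgebra, NumberField.IsTotallyReal (EndField A hF) ∧
          Module.finrank ℚ A.endAlgebra = A.dim) →
        (¬ ∃ hF : IsField A.endAlgebra, NumberField.IsTotallyReal (EndField A hF) ∧
          2 * Module.finrank ℚ A.endAlgebra = A.dim) →
        (¬ ∃ (K : Type) (_ : Field K) (_ : NumberField K) (_ : IsTotallyReal K) (_ : Algebra K A.endAlgebra)
          (_ : IsScalarTower ℚ K A.endAlgebra) (_ : IsQuaternionAlgebra K A.endAlgebra),
            IsTotallyIndefinite K A.endAlgebra ∧ A.dim = 4 * Module.finrank ℚ K) →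
        (¬ ∃ (φ : A ⟶ A) (μ₁ μ₂ : ℂ), Module.finrank ℚ A.endAlgebra = 4 ∧ starRingEnd ℂ μ₁ ≠ μ₁ ∧
          starRingEnd ℂ μ₂ ≠ μ₂ ∧ μ₂ ≠ μ₁ ∧ μ₂ ≠ starRingEnd ℂ μ₁ ∧ eigenMultiplicity A φ μ₁ = 1 ∧
          eigenMultiplicity A φ (starRingEnd ℂ μ₁) = 1 ∧ eigenMultiplicity A φ μ₂ = 2) →
        Module.finrank ℚ A.endAlgebra ≠ 1 →
        IsCodimTwoDivisorWeilGenerated A := by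
  constructor
  · intro h A hA _ _ _ _ _ _ _ _ _
    exact isCodimTwoDivisorWeilGenerated_of_dim_eq_four_of_fact h hA
  · intro h
    rw [moonenZarhin1999_codimTwoHodgeClasses_abelianFourfold_iff_residual_noSymplecticTypeIOne]
    intro A hA hs hcm hK hQ hT hR hII hC _
    by_cases h1 : Module.finrank ℚ A.endAlgebra = 1
    · exact isCodimTwoDivisorWeilGenerated_of_finrank_endAlgebra_eq_one h1 hA
    · exact h A hA hs hcm hK hQ hT hR hII hC h1

/-! ### §2 The HC axis modulo MARKMAN ALONE: row four without types IV(1,1), I(2), II over `ℚ` and I(1) -/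

/-- **`HCUpToDim 5` MODULO MARKMAN ALONE, TYPES IV(1,1), I(2), II OVER `ℚ` AND I(1) REMOVED**: granted
`Markman2025_weilClasses_algebraic_abelianFourfold` (hypothesis; no `HC_CM`), the Hodge conjecture for all complex abelian
varieties of dimension `≤ 5` is EQUIVALENT to the Hodge conjecture on the simple non-CM FOURFOLDS with `finrank_ℚ End⁰ ≠ 1`
whose endomorphism algebra is NOT an imaginary quadratic field and which are of none of the five types minimal quaternion,
maximal real multiplication, real multiplication of relative dimension two, type II of quaternion rank two, quartic CM
`{(1,1),(2,0)}` — what is left of Moonen–Zarhin 1995: III over `ℚ`, IV(2,1) `⊇ k` of signature `(2,2)`, IV with `d = 2`.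
[cite: MoonenZarhin1999LowDim, Thm. 0.1, Thm. 0.2, §1 (1.8) and §2 (2.5)] [cite: MoonenZarhin1995Duke, §2 (type I(1))]
[claim: Markman2025SurveySecant, status: under-review] -/
theorem hcUpToDim_five_iff_rowFour_noTypeIOne_of_markman
    (hMark : Markman2025_weilClasses_algebraic_abelianFourfold) :
    HCUpToDim 5 ↔ HCOnClass fun A => A.dim = 4 ∧ A.IsSimple ∧ ¬ IsOfCMType A ∧
      (¬ ∃ (φ : A ⟶ A) (d : ℕ), 0 < d ∧ φ ≫ φ = -(d • 𝟙 A) ∧ Module.finrank ℚ A.endAlgebra = 2) ∧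
      (¬ ∃ (K : Type) (_ : Field K) (_ : NumberField K) (_ : IsTotallyReal K) (_ : Algebra K A.endAlgebra)
        (_ : IsScalarTower ℚ K A.endAlgebra) (_ : IsQuaternionAlgebra K A.endAlgebra), A.dim = 2 * Module.finrank ℚ K) ∧
      (¬ ∃ hF : IsField A.endAlgebra, IsTotallyReal (EndField A hF) ∧ Module.finrank ℚ A.endAlgebra = A.dim) ∧
      (¬ ∃ hF : IsField A.endAlgebra, IsTotallyReal (EndField A hF) ∧ 2 * Module.finrank ℚ A.endAlgebra = A.dim) ∧
      (¬ ∃ (K : Type) (_ : Field K) (_ : NumberField K) (_ : IsTotallyReal K) (_ : Algebra K A.endAlgebra)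
        (_ : IsScalarTower ℚ K A.endAlgebra) (_ : IsQuaternionAlgebra K A.endAlgebra),
          IsTotallyIndefinite K A.endAlgebra ∧ A.dim = 4 * Module.finrank ℚ K) ∧
      (¬ ∃ (φ : A ⟶ A) (μ₁ μ₂ : ℂ), Module.finrank ℚ A.endAlgebra = 4 ∧ starRingEnd ℂ μ₁ ≠ μ₁ ∧
        starRingEnd ℂ μ₂ ≠ μ₂ ∧ μ₂ ≠ μ₁ ∧ μ₂ ≠ starRingEnd ℂ μ₁ ∧ eigenMultiplicity A φ μ₁ = 1 ∧
        eigenMultiplicity A φ (starRingEnd ℂ μ₁) = 1 ∧ eigenMultiplicity A φ μ₂ = 2) ∧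
      Module.finrank ℚ A.endAlgebra ≠ 1 := by
  constructor
  · intro h5
    exact hcOnClass_mono (fun A hA => show A.dim ≤ 5 by rw [hA.1]; norm_num) h5
  · intro h
    rw [hcUpToDim_five_iff_rowFour_noSymplecticTypeIOne_of_markman hMark]
    rintro A ⟨hA4, hs, hcm, hK, hQ, hT, hR, hII, hC, -⟩
    by_cases h1 : Module.finrank ℚ A.endAlgebra = 1
    · exact hodgeConjectureFor_of_finrank_endAlgebra_eq_one h1 hA4
    · exact h A ⟨hA4, hs, hcm, hK, hQ, hT, hR, hII, hC, h1⟩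

/-- **`HCAtDim 4` MODULO MARKMAN, TYPES IV(1,1), I(2), II OVER `ℚ` AND I(1) REMOVED** (the row-`4` cell alone).
[cite: MoonenZarhin1999LowDim, Thm. (0.1)(3) and §1 (1.8)] [cite: MoonenZarhin1995Duke, §2 (type I(1))]
[claim: Markman2025SurveySecant, status: under-review] -/
theorem hcAtDim_four_iff_rowFour_noTypeIOne_of_markman
    (hMark : Markman2025_weilClasses_algebraic_abelianFourfold) :
    HCAtDim 4 ↔ HCOnClass fun A => A.dim = 4 ∧ A.IsSimple ∧ ¬ IsOfCMType A ∧
      (¬ ∃ (φ : A ⟶ A) (d : ℕ), 0 < d ∧ φ ≫ φ = -(d • 𝟙 A) ∧ Module.finrank ℚ A.endAlgebra = 2) ∧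
      (¬ ∃ (K : Type) (_ : Field K) (_ : NumberField K) (_ : IsTotallyReal K) (_ : Algebra K A.endAlgebra)
        (_ : IsScalarTower ℚ K A.endAlgebra) (_ : IsQuaternionAlgebra K A.endAlgebra), A.dim = 2 * Module.finrank ℚ K) ∧
      (¬ ∃ hF : IsField A.endAlgebra, IsTotallyReal (EndField A hF) ∧ Module.finrank ℚ A.endAlgebra = A.dim) ∧
      (¬ ∃ hF : IsField A.endAlgebra, IsTotallyReal (EndField A hF) ∧ 2 * Module.finrank ℚ A.endAlgebra = A.dim) ∧
      (¬ ∃ (K : Type) (_ : Field K) (_ : NumberField K) (_ : IsTotallyReal K) (_ : Algebra K A.endAlgebra)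
        (_ : IsScalarTower ℚ K A.endAlgebra) (_ : IsQuaternionAlgebra K A.endAlgebra),
          IsTotallyIndefinite K A.endAlgebra ∧ A.dim = 4 * Module.finrank ℚ K) ∧
      (¬ ∃ (φ : A ⟶ A) (μ₁ μ₂ : ℂ), Module.finrank ℚ A.endAlgebra = 4 ∧ starRingEnd ℂ μ₁ ≠ μ₁ ∧
        starRingEnd ℂ μ₂ ≠ μ₂ ∧ μ₂ ≠ μ₁ ∧ μ₂ ≠ starRingEnd ℂ μ₁ ∧ eigenMultiplicity A φ μ₁ = 1 ∧
        eigenMultiplicity A φ (starRingEnd ℂ μ₁) = 1 ∧ eigenMultiplicity A φ μ₂ = 2) ∧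
      Module.finrank ℚ A.endAlgebra ≠ 1 := by
  constructor
  · exact fun h => hcOnClass_mono (fun A hA => hA.1) h
  · intro h
    have h5 : HCUpToDim 5 := (hcUpToDim_five_iff_rowFour_noTypeIOne_of_markman hMark).2 h
    exact hcOnClass_mono (fun A (hA : A.dim = 4) => show A.dim ≤ 5 by omega) h5

omit [HodgeTensorFacts.{0, 0}] in
/-- **On path**: the residual class is a case of the summit. [cite: Deligne2000, §1] -/
theorem rowFourNoTypeIOne_hcOnClass_of_hodgeConjecture (h : _root_.HodgeConjecture) :
    HCOnClass fun A => A.dim = 4 ∧ A.IsSimple ∧ ¬ IsOfCMType A ∧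
      (¬ ∃ (φ : A ⟶ A) (d : ℕ), 0 < d ∧ φ ≫ φ = -(d • 𝟙 A) ∧ Module.finrank ℚ A.endAlgebra = 2) ∧
      (¬ ∃ (K : Type) (_ : Field K) (_ : NumberField K) (_ : IsTotallyReal K) (_ : Algebra K A.endAlgebra)
        (_ : IsScalarTower ℚ K A.endAlgebra) (_ : IsQuaternionAlgebra K A.endAlgebra), A.dim = 2 * Module.finrank ℚ K) ∧
      (¬ ∃ hF : IsField A.endAlgebra, IsTotallyReal (EndField A hF) ∧ Module.finrank ℚ A.endAlgebra = A.dim) ∧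
      (¬ ∃ hF : IsField A.endAlgebra, IsTotallyReal (EndField A hF) ∧ 2 * Module.finrank ℚ A.endAlgebra = A.dim) ∧
      (¬ ∃ (K : Type) (_ : Field K) (_ : NumberField K) (_ : IsTotallyReal K) (_ : Algebra K A.endAlgebra)
        (_ : IsScalarTower ℚ K A.endAlgebra) (_ : IsQuaternionAlgebra K A.endAlgebra),
          IsTotallyIndefinite K A.endAlgebra ∧ A.dim = 4 * Module.finrank ℚ K) ∧
      (¬ ∃ (φ : A ⟶ A) (μ₁ μ₂ : ℂ), Module.finrank ℚ A.endAlgebra = 4 ∧ starRingEnd ℂ μ₁ ≠ μ₁ ∧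
        starRingEnd ℂ μ₂ ≠ μ₂ ∧ μ₂ ≠ μ₁ ∧ μ₂ ≠ starRingEnd ℂ μ₁ ∧ eigenMultiplicity A φ μ₁ = 1 ∧
        eigenMultiplicity A φ (starRingEnd ℂ μ₁) = 1 ∧ eigenMultiplicity A φ μ₂ = 2) ∧
      Module.finrank ℚ A.endAlgebra ≠ 1 :=
  hcOnClass_of_hodgeConjecture _ h

end Summit.HodgeConjecture.Ring2.RowFourTypeIOneClosed

end
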